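import Literature.AnabelianGeometry.EtaleTheta.ThetaCoversLampModelDefs

/-!
# The lamplighter model of `ThetaCovers.TemperedCoverData` ([EtTh] §2), part 1b (DEF-BEARING): named elements of
# `Q̂` and `Q₀` — `mkQ`, `mkQt`, the rotations `ζ^k`, coherence across levels, the basic open subgroups `lev N`

S. Mochizuki, *The étale theta function …*, Publ. RIMS **45** (2009) [MochizukiEtTh2009], §2, Def. 2.5 p. 39–40, Lemma 2.17 (ii)
p. 58 [cite: MochizukiEtTh2009, Lem 2.17(ii) p.58].  abc-iut cell, block F, seat abc-iut-f-142 (row F-0606, INSTANCE form); sequel of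
`ThetaCoversLampModelDefs.lean` (the tower `Q̂`, `A`, `Φ`, `Q₀`, `deg`, `ι`).  Toy bookkeeping only:
* `mkQ m k : Q̂` — configurations `m`, integer rotation `k` at every level; `mkQt m k : Q₀` when `m` is position-wise
  eventually constant (`EvCF`); `zeta k = ζ^k` (lamps off) and the homomorphism `zetaHom : ℤ → Q₀` (a section of `deg`);
* `coh` — coherence of rotation parts across several levels; `intCast_val_eq_right` — the integer lift of a level;
* `lev N` — the open normal subgroups `{y | y_n = 1, n < N}` of `Q̂` (a neighbourhood basis of `1`).

HONEST FRAMING. A DESIGNED consistency witness for OUR typed interface (`G_K = 1`; lamplighter groups, not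
fundamental groups of curves): it decides which typed sentences are CONSEQUENCES of the interface and which are not;
nothing of [EtTh] is asserted or denied for genuine tempered fundamental groups; instance-at-a-designed-carrier ≠ the
printed lemma; no side is taken on [IUTchIII] Cor. 3.12 or on any author; nothing here bears on abc. typed ≠ proved.
-/

noncomputable section

namespace Literature.AnabelianGeometry.EtaleTheta

namespace ThetaCovers

namespace LampModel

section Part_1b

open Multiplicative

/-! ## 5. Named elements of `Q̂` and `Q₀` -/

/-- Position-wise eventual constancy for a family of configurations. (toy bookkeeping)
[cite: MochizukiEtTh2009, Lem 2.17(ii) p.58] -/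
def EvCF (m : ∀ n, F n) : Prop := ∀ i : ℤ, ∃ N : ℕ, ∃ c : S, ∀ n, N ≤ n → m n (i : ZMod (Nl n)) = c

/-- The trivial family is position-wise eventually constant. (toy bookkeeping) [cite: MochizukiEtTh2009, Lem 2.17(ii) p.58] -/
theorem evCF_one : EvCF (fun _ => 1) := fun _ => ⟨0, 1, fun _ _ => rfl⟩

/-- An eventually trivial family is position-wise eventually constant. (toy bookkeeping)
[cite: MochizukiEtTh2009, Lem 2.17(ii) p.58] -/
theorem evCF_of_eventually_one {m : ∀ n, F n} {N : ℕ} (h : ∀ n, N ≤ n → m n = 1) : EvCF m :=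
  fun i => ⟨N, 1, fun n hn => by rw [h n hn]; rfl⟩

/-- The element of `Q̂` with configurations `m` and INTEGER rotation part `k`. (toy bookkeeping)
[cite: MochizukiEtTh2009, Lem 2.17(ii) p.58] -/
def mkQ (m : ∀ n, F n) (k : ℤ) : Qc :=
  ⟨fun n => ⟨m n, ofAdd (k : ZMod (Nl n))⟩, fun n => by simp [red]⟩

/-- Levels of `mkQ`. (toy bookkeeping) [cite: MochizukiEtTh2009, Lem 2.17(ii) p.58] -/
@[simp] theorem mkQ_apply (m : ∀ n, F n) (k : ℤ) (n : ℕ) :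
    ((mkQ m k : Qc) : Qfull) n = ⟨m n, ofAdd (k : ZMod (Nl n))⟩ := rfl

/-- Levels of a degree-`0` `mkQ`. (toy bookkeeping) [cite: MochizukiEtTh2009, Lem 2.17(ii) p.58] -/
theorem mkQ_zero_apply (m : ∀ n, F n) (n : ℕ) : ((mkQ m 0 : Qc) : Qfull) n = ⟨m n, 1⟩ := by
  rw [mkQ_apply, Int.cast_zero, ofAdd_zero]

/-- Products of `mkQ`'s. (toy bookkeeping) [cite: MochizukiEtTh2009, Lem 2.17(ii) p.58] -/
theorem mkQ_mul (m m' : ∀ n, F n) (k k' : ℤ) :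
    mkQ m k * mkQ m' k' = mkQ (fun n => m n * rot n (ofAdd (k : ZMod (Nl n))) (m' n)) (k + k') := by
  refine Subtype.ext (funext fun n => SemidirectProduct.ext rfl ?_)
  change ofAdd (k : ZMod (Nl n)) * ofAdd (k' : ZMod (Nl n)) = ofAdd ((k + k' : ℤ) : ZMod (Nl n))
  rw [← ofAdd_add, Int.cast_add]

/-- The element of `Q₀` with configurations `m` (position-wise eventually constant) and degree `k`.
(toy bookkeeping) [cite: MochizukiEtTh2009, Lem 2.17(ii) p.58] -/
def mkQt (m : ∀ n, F n) (k : ℤ) (hm : EvCF m) : Qt :=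
  ⟨(mkQ m k, ofAdd k), ⟨fun _ => rfl, hm⟩⟩

/-- `Q̂`-component of `mkQt`. (toy bookkeeping) [cite: MochizukiEtTh2009, Lem 2.17(ii) p.58] -/
@[simp] theorem mkQt_fst (m : ∀ n, F n) (k : ℤ) (hm : EvCF m) :
    ((mkQt m k hm : Qt) : Qc × Multiplicative ℤ).1 = mkQ m k := rfl

/-- Degree of `mkQt`. (toy bookkeeping) [cite: MochizukiEtTh2009, Lem 2.17(ii) p.58] -/
@[simp] theorem mkQt_snd (m : ∀ n, F n) (k : ℤ) (hm : EvCF m) :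
    ((mkQt m k hm : Qt) : Qc × Multiplicative ℤ).2 = ofAdd k := rfl

/-- The pure rotations `ζ^k ∈ Q₀` (all lamps off, degree `k`). (toy bookkeeping) [cite: MochizukiEtTh2009, Lem 2.17(ii) p.58] -/
def zeta (k : ℤ) : Qt := mkQt (fun _ => 1) k evCF_one

/-- `ζ^k · ζ^{k'} = ζ^{k+k'}`. (toy bookkeeping) [cite: MochizukiEtTh2009, Lem 2.17(ii) p.58] -/
theorem zeta_mul (k k' : ℤ) : zeta k * zeta k' = zeta (k + k') := by
  refine Subtype.ext (Prod.ext ?_ ?_)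
  · change mkQ _ k * mkQ _ k' = mkQ _ (k + k')
    rw [mkQ_mul]
    congr 1
  · change ofAdd k * ofAdd k' = ofAdd (k + k')
    rw [ofAdd_add]

/-- `ℤ → Q₀`, `k ↦ ζ^k`, as a homomorphism (a set-theoretic section of the degree). (toy bookkeeping)
[cite: MochizukiEtTh2009, Lem 2.17(ii) p.58] -/
def zetaHom : Multiplicative ℤ →* Qt where
  toFun k := zeta (toAdd k)
  map_one' := by
    refine Subtype.ext (Prod.ext (Subtype.ext (funext fun n => SemidirectProduct.ext rfl ?_)) rfl)
    change ofAdd (((toAdd (1 : Multiplicative ℤ)) : ℤ) : ZMod (Nl n)) = 1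
    rw [toAdd_one, Int.cast_zero, ofAdd_zero]
  map_mul' a b := by
    change zeta (toAdd (a * b)) = zeta (toAdd a) * zeta (toAdd b)
    rw [toAdd_mul, zeta_mul]

/-- Lamps of `ζ^k` are off. (toy bookkeeping) [cite: MochizukiEtTh2009, Lem 2.17(ii) p.58] -/
theorem zetaHom_apply_left (k : Multiplicative ℤ) (n : ℕ) :
    ((((zetaHom k : Qt) : Qc × Multiplicative ℤ).1 : Qfull) n).left = 1 := rfl

/-- Rotation parts of `ζ^k`. (toy bookkeeping) [cite: MochizukiEtTh2009, Lem 2.17(ii) p.58] -/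
theorem zetaHom_apply_right (k : Multiplicative ℤ) (n : ℕ) :
    ((((zetaHom k : Qt) : Qc × Multiplicative ℤ).1 : Qfull) n).right = ofAdd ((toAdd k : ℤ) : ZMod (Nl n)) :=
  rfl

/-- Degree of `ζ^k` is `k`. (toy bookkeeping) [cite: MochizukiEtTh2009, Lem 2.17(ii) p.58] -/
theorem zetaHom_snd (k : Multiplicative ℤ) : ((zetaHom k : Qt) : Qc × Multiplicative ℤ).2 = k := by
  change ofAdd (toAdd k) = k
  rw [ofAdd_toAdd]

/-- Coherence across several levels: `a_n ↦ a_m` under `ℤ/N_n → ℤ/N_m` (`m ≤ n`). (toy bookkeeping)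
[cite: MochizukiEtTh2009, Lem 2.17(ii) p.58] -/
theorem coh (q : Qc) {m n : ℕ} (h : m ≤ n) :
    ZMod.castHom (Nl_dvd h) (ZMod (Nl m)) (toAdd ((q : Qfull) n).right) = toAdd ((q : Qfull) m).right := by
  induction n, h using Nat.le_induction with
  | base => exact ZMod.cast_id _ _
  | succ n hmn ih =>
    rw [← ih, ← q.2 n]
    obtain ⟨z, hz⟩ := ZMod.intCast_surjective (toAdd ((q : Qfull) (n + 1)).right)
    rw [← hz]
    simp only [red, map_intCast]

/-- The integer lift `(a_N).val` of the level-`N` rotation part reduces to `a_n` for `n ≤ N`. (toy bookkeeping)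
[cite: MochizukiEtTh2009, Lem 2.17(ii) p.58] -/
theorem intCast_val_eq_right (q : Qc) {n N : ℕ} (h : n ≤ N) :
    ((((toAdd ((q : Qfull) N).right).val : ℕ) : ℤ) : ZMod (Nl n)) = toAdd ((q : Qfull) n).right := by
  rw [Int.cast_natCast, ZMod.natCast_val, ← ZMod.castHom_apply (h := Nl_dvd h)]
  exact coh q h

/-- The basic open normal subgroups `{y | y_n = 1 for n < N}` of `Q̂`. (toy bookkeeping)
[cite: MochizukiEtTh2009, Lem 2.17(ii) p.58] -/
def lev (N : ℕ) : Subgroup Qc where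
  carrier := {y | ∀ n, n < N → (y : Qfull) n = 1}
  one_mem' := fun _ _ => rfl
  mul_mem' {a b} ha hb n hn := by
    change (a : Qfull) n * (b : Qfull) n = 1
    rw [ha n hn, hb n hn, one_mul]
  inv_mem' {a} ha n hn := by
    change ((a : Qfull) n)⁻¹ = 1
    rw [ha n hn, inv_one]

/-- `lev N` is normal. (toy bookkeeping) [cite: MochizukiEtTh2009, Lem 2.17(ii) p.58] -/
theorem lev_normal (N : ℕ) : (lev N).Normal := by
  refine ⟨fun a ha g n hn => ?_⟩
  change (g : Qfull) n * (a : Qfull) n * ((g : Qfull) n)⁻¹ = 1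
  rw [ha n hn, mul_one, mul_inv_cancel]

/-- `lev N` is open. (toy bookkeeping) [cite: MochizukiEtTh2009, Lem 2.17(ii) p.58] -/
theorem isOpen_lev (N : ℕ) : IsOpen (lev N : Set Qc) := by
  have : (lev N : Set Qc) = ⋂ n ∈ Finset.range N, (fun y : Qc => (y : Qfull) n) ⁻¹' {1} := by
    ext y
    simp only [Set.mem_iInter, Set.mem_preimage, Set.mem_singleton_iff, Finset.mem_range]
    rfl
  rw [this]
  refine isOpen_biInter_finset fun n _ => ?_
  exact (isOpen_discrete _).preimage ((continuous_apply n).comp continuous_subtype_val)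

/-- The conjugate family `μ · (a • m) · μ⁻¹`, position-wise: `j ↦ μ_n(j) · m_n(j − a_n) · μ_n(j)⁻¹`. (toy bookkeeping)
[cite: MochizukiEtTh2009, Lem 2.17(ii) p.58] -/
def conjF (μ : ∀ n, F n) (a : ∀ n, ZMod (Nl n)) (m : ∀ n, F n) : ∀ n, F n :=
  fun n j => μ n j * m n (j - a n) * (μ n j)⁻¹

end Part_1b

end LampModel

end ThetaCovers

end Literature.AnabelianGeometry.EtaleTheta
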